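import Summits.Ventures.Crystal3D.Theorems.StickyWulffConstantGenericWallFloorSlotDozens
import Summits.Ventures.Crystal3D.Theorems.StickyWulffConstantGenericWallFloorExactOnly
import HarnessLib

/-!
# `SingleDozen` classified: three independent own slots outside every «hexagon + polar triple»
# (crux `GenericWallFloor`, line `WallLedgerG`; E2 single-dozen algebra in the E2 vocabulary)

HONEST FRAMING. Part of the venture `Summits/Ventures/Crystal3D` (cell `crystal3d-full`), helper
`--supports` the crux `GenericWallFloor` (stmt-Ventures-19480) of `route-Ventures-StickyWulffConstant`,
registered line `WallLedgerG`, open stub `stub_twoSlabAdhesion` — general-filling step, per-ball programme E2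
(cf-p1 ROUTE.md §80).  The E2 interface `…GenericWallFloorExactOnly` (planner sketch) phrases the per-ball
step `unsaturated_of_exactOnly` with the hypothesis `SingleDozen c slots O` («lattice algebra per pattern»).
Here it is DISCHARGED from the dozen rigidity of `…SlotDozens`:

**`singleDozen_of_three_independent`** — if the own pattern `O` around `c` contains three slot positions
`c + A wᵢ` with `w₁, w₂, w₃` linearly independent and, for every unit `{111}` normal `n` of the grain `A`,
a slot position `c + A w` with `⟪A w, n⟫ > 0`, then `SingleDozen c (fccSlots.image (c + A ·)) O`.
(Three independent slots pin a close-packed dozen to the slot dozen or one of the eight twins; the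
witnesses exclude the twins, whose own part is «hexagon + polar triple», `slot_mem_twinDozen_iff`.)
`dist_eq_one_of_mem_slotImage` supplies the `hslots` hypothesis of `unsaturated_of_exactOnly`.

WHAT THIS IS NOT: no certificate (E1), no flow (E3); rung F-C1 not moved.
-/

noncomputable section

namespace Summit.Ventures.Crystal3D.Theorems

open Finset
open Literature.Geometry.DiscreteGeometry (fccKissingPattern hcpKissingPattern)
open scoped InnerProductSpace

/-- Reading a translated dozen: `x ∈ D` iff `x − c` is a vector of the pattern image. -/
theorem mem_of_coe_eq_image_add {D P : Finset (EuclideanSpace ℝ (Fin 3))}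
    {B : EuclideanSpace ℝ (Fin 3) →ₗᵢ[ℝ] EuclideanSpace ℝ (Fin 3)} {c x : EuclideanSpace ℝ (Fin 3)}
    (hD : (↑D : Set (EuclideanSpace ℝ (Fin 3))) = (fun p => B p + c) '' ↑P) :
    x ∈ D ↔ x - c ∈ B '' (↑P : Set (EuclideanSpace ℝ (Fin 3))) := by
  constructor
  · intro hx
    have : x ∈ (↑D : Set (EuclideanSpace ℝ (Fin 3))) := hx
    rw [hD] at this
    obtain ⟨p, hp, rfl⟩ := this
    exact ⟨p, hp, by simp⟩
  · rintro ⟨p, hp, hpx⟩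
    have : x ∈ (fun p => B p + c) '' (↑P : Set (EuclideanSpace ℝ (Fin 3))) :=
      ⟨p, hp, by show B p + c = x; rw [hpx, sub_add_cancel]⟩
    rw [← hD] at this
    exact this

/-- **`SingleDozen` from three independent own slots and a witness against every twin.**  Let the own
pattern `O` around `c` contain three slot positions `c + A wᵢ` of the grain `A` with `w₁, w₂, w₃` linearly
independent, and — for every unit `{111}` normal `n` of the grain — a slot position `c + A w` with
`⟪A w, n⟫ > 0` (i.e. the slots of `O` lie in none of the eight nine-sets «hexagon + polar triple»).  Then the
only close-packed dozen around `c` containing `O` is the slot dozen `{c + A w}`: `SingleDozen` in the sense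
of `…GenericWallFloorExactOnly` (no hypothesis that `O` consists of slot positions only is needed). -/
theorem singleDozen_of_three_independent
    (A : EuclideanSpace ℝ (Fin 3) ≃ₗᵢ[ℝ] EuclideanSpace ℝ (Fin 3)) (c : EuclideanSpace ℝ (Fin 3))
    {O : Finset (EuclideanSpace ℝ (Fin 3))}
    {w₁ w₂ w₃ : EuclideanSpace ℝ (Fin 3)} (hw₁ : w₁ ∈ fccSlots) (hw₂ : w₂ ∈ fccSlots) (hw₃ : w₃ ∈ fccSlots)
    (h₁ : c + A w₁ ∈ O) (h₂ : c + A w₂ ∈ O) (h₃ : c + A w₃ ∈ O)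
    (hind : LinearIndependent ℝ ![w₁, w₂, w₃])
    (hnot : ∀ n : EuclideanSpace ℝ (Fin 3), ‖n‖ = 1 →
      (∀ w ∈ fccSlots, ⟪A w, n⟫_ℝ = 0 ∨ ⟪A w, n⟫_ℝ = Real.sqrt (2 / 3) ∨ ⟪A w, n⟫_ℝ = -Real.sqrt (2 / 3)) →
      ∃ w ∈ fccSlots, 0 < ⟪A w, n⟫_ℝ ∧ c + A w ∈ O) :
    SingleDozen c (fccSlots.image fun w => c + A w) O := by
  classical
  intro D hD hOD
  obtain ⟨B, hB⟩ := hD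
  -- the three own slots as vectors of the dozen
  have vec : ∀ {P : Finset (EuclideanSpace ℝ (Fin 3))},
      (↑D : Set (EuclideanSpace ℝ (Fin 3))) = (fun p => B p + c) '' ↑P →
      ∀ {w}, w ∈ fccSlots → c + A w ∈ O →
        A w ∈ B '' (↑P : Set (EuclideanSpace ℝ (Fin 3))) ∧
          A w ∈ A '' (↑fccSlots : Set (EuclideanSpace ℝ (Fin 3))) := by
    intro P hP w hw hcw
    have := (mem_of_coe_eq_image_add hP).1 (hOD hcw)
    rw [add_sub_cancel_left] at this
    exact ⟨this, ⟨w, hw, rfl⟩⟩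
  have hindA := linearIndependent_map_triple A hind
  rcases hB with hB | hB
  · -- fcc type: the dozen is the slot dozen
    obtain ⟨a₁, a₂⟩ := vec hB hw₁ h₁
    obtain ⟨b₁, b₂⟩ := vec hB hw₂ h₂
    obtain ⟨c₁, c₂⟩ := vec hB hw₃ h₃
    have hdoz := fccDozen_eq_slots_of_three_independent A B a₁ b₁ c₁ a₂ b₂ c₂ hindA
    ext x
    rw [mem_of_coe_eq_image_add hB, hdoz, Finset.mem_image]
    constructor
    · rintro ⟨w, hw, hwx⟩
      exact ⟨w, hw, by rw [hwx]; abel⟩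
    · rintro ⟨w, hw, rfl⟩
      exact ⟨w, hw, by abel⟩
  · -- hcp type: impossible — the own part would lie in a «hexagon + polar triple»
    exfalso
    obtain ⟨a₁, a₂⟩ := vec hB hw₁ h₁
    obtain ⟨b₁, b₂⟩ := vec hB hw₂ h₂
    obtain ⟨c₁, c₂⟩ := vec hB hw₃ h₃
    obtain ⟨n, hn1, hmenu, hdoz⟩ := hcpDozen_twin_of_three_independent A B a₁ b₁ c₁ a₂ b₂ c₂ hindA
    obtain ⟨w, hw, hpos, hcw⟩ := hnot n hn1 hmenu
    obtain ⟨hwB, -⟩ := vec hB hw hcw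
    have := (slot_mem_twinDozen_iff A hn1 hmenu hdoz hw).1 (hdoz ▸ hwB)
    linarith

/-- **The slot positions are at unit distance** (hypothesis `hslots` of `unsaturated_of_exactOnly`). -/
theorem dist_eq_one_of_mem_slotImage (A : EuclideanSpace ℝ (Fin 3) ≃ₗᵢ[ℝ] EuclideanSpace ℝ (Fin 3))
    (c : EuclideanSpace ℝ (Fin 3)) :
    ∀ s ∈ fccSlots.image (fun w => c + A w), dist c s = 1 := by
  classical
  intro s hs
  obtain ⟨w, hw, rfl⟩ := Finset.mem_image.1 hs
  rw [dist_self_add_right, LinearIsometryEquiv.norm_map, norm_eq_one_of_mem_fccSlots hw]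

end Summit.Ventures.Crystal3D.Theorems

end
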